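import Literature.MathematicalPhysics.QuantumFieldTheory.Balaban1983to89.B8Eq133Hypotheses
import Literature.MathematicalPhysics.QuantumFieldTheory.Balaban1983to89.BlockAveragingFederbush

/-!
# `Balaban1983to89.B9Eq335AxialCriterion` — [Balaban1985BackgroundPropagators] (3.35) p. 396 («the regularity condition» of a
# background, = the second clause of [Balaban1985RegularSpaces] (1.33) p. 82): AN ELEMENTARY SUFFICIENT CRITERION on the ℤᵈ carriers —
# a `U1`-valued configuration whose plaquette variables are within `α₀η²` of `1` AND whose transported plaquette differences are
# `≤ c₀η³` satisfies (3.35) (`B8Eq133Hypotheses.Reg335Zd`) on EVERY family of sets of `ℓ¹`-radius `≤ M·Lʲ` at scales `Lʲη ≤ 1`, with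
# `O(1)Mα₀ := 2(M+1)α₀ + 2Mc₀ + 4M(1+2M)α₀²`, IN THE COMPLETE AXIAL GAUGE of [Balaban1985Averaging] p. 24 (`B7Prop1Explicit.axialFn`)

statement-level skeleton of published theorems with citation tags; proofs where landed; nothing here is a claim about the Yang–Mills mass gap

CITATION HEADER (lean-in-tree rule).  Cell `pub-ymgap` (YM-PLAN Track A, HUMAN RULING D-0062), seat `pub-ymgap-dag-n16-b` (FIRST-MISSING-ESTIMATE
seat of DAG node N16 = NE3; writer prover-pub-ymgap-dag-n16-b-g2-0, 2026-08-26).  Sources: T. Bałaban, *Propagators for lattice gauge theories in a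
background field*, Commun. Math. Phys. **99** (1985) 389–434 [Balaban1985BackgroundPropagators] ("[4]" of B8; cell paper B9), (3.35) p. 396 — typed
by r06 as `B9Eq335RegularityClasses.Reg335Cube ∕ Reg335` and transported to the ℤᵈ carrier by r05 as `B8Eq133Hypotheses.Reg335Zd`; T. Bałaban,
*Spaces of regular gauge field configurations on a lattice and gauge fixing conditions*, Commun. Math. Phys. **99** (1985) 75–102
[Balaban1985RegularSpaces] (B8), (1.33) p. 82 and pp. 98–99; T. Bałaban, *Averaging operations for lattice gauge theories*, Commun. Math. Phys. **98**
(1985) 17–51 [Balaban1985Averaging] (B7), pp. 24–25 (the axial gauge `v₀(x) = V(Γ_{y,x})` and «|V₀,b − 1| < |b₋ − y|α₀», kernel-certified as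
`B7Prop1Explicit.axial_bond_bound`).  Held texts `paper:balaban1985-cmp99-background-propagators` p0008, `paper:balaban1985-cmp99-regular-spaces-gauge-fixing`
p0008, p0024–p0025 (read by this seat, 2026-08-26).

WHAT IS PRINTED (verbatim).  [4] p. 396: «for an arbitrary cube □ of the described above class, and for a configuration U there exists a gauge
transformation u on □ such that U^u = e^{iηA}. and if the index of □ is j, then |A| < O(1)Mα₀(Lʲη)⁻¹, |∇^ηA| < O(1)Mα₀(Lʲη)⁻² on □, where O(1)M is
a size of □ in T_{L^{−j}}; (3.35)».  B8 p. 82: «U₀ ∈ 𝔄_k({Ω_j}, α₀), U₀ satisfies the regularity condition (3.35) in [4]. (1.33) … We will see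
later that this condition is a consequence of the first one in (1.33), so eventually we will drop it out of the assumptions.»  B8 p. 98: «the
gradient ∇^ηA in (1.127) is the ordinary finite difference gradient. Of course (1.127) implies the regularity condition (3.35).»  B8 p. 99: «The
configuration U₁ in a neighborhood of □ is obtained from U₀ by a gauge transformation, hence for α₀ sufficiently small we have proved the
regularity condition (3.35).»  B7 pp. 24–25: «we make a gauge transformation v₀ such that the gauge transformed configuration V₀ = V^{v₀}
satisfies the conditions V₀(Γ_{y,x}) = 1. … The conditions V₀(Γ_{y,x}) = 1 imply V₀(x, x + e₁) = 1, |V₀(x, x + e₂) − 1| < |x₁ − y₁|α₀, …».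

WHAT THIS FILE PROVES AND WHAT IT DOES NOT.  PRINT derives (3.35) for a background `U₀ ∈ 𝔄_k` from THEOREM 4 at the trivial background
(Proposition 6, B8 p. 99; tree: `B8Prop6OfThm4.prop6_of_thm4`, `B8Eq119TwistedAxial.prop6_of_thm4At` — conditional on `Thm4At`).  THIS FILE does
NOT do that.  It proves an ELEMENTARY SUFFICIENT CRITERION under a STRONGER hypothesis than `𝔄_k`: besides the plaquette radius `|V(∂p) − 1| ≤ α₀η²`
(the (1.7)-clause of `𝔄_k` at the top level) it assumes a TRANSPORTED PLAQUETTE-GRADIENT radius `|R(V(b))V(∂(p + b)) − V(∂p)| ≤ c₀η³` (all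
plaquettes `p`, all bonds `b` at the base point of `p`) — a hypothesis `𝔄_k` does NOT contain ((1.9) bounds only the covariant DIVERGENCE of the
plaquette field), but which the backgrounds of the NE3 pair DO carry (the (H3ˢᵘᵖ) sup-regularity letters of [Balaban1985Variational] Thm 1 (8)+(10)
TYPE, `Spine/NE3`'s `RegularSup`; consumer `Spine/NE3/PairReg335B8`).  Under it, (3.35) holds IN THE COMPLETE AXIAL GAUGE `v₀ = axialFn V y` of
[Balaban1985Averaging] p. 24 based at any point `y`, on every set of `ℓ¹`-radius `R` around `y`: `|V₀(b) − 1| ≤ Rα₀η²` (B7 p. 25 l. 3 =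
`B7Prop1Explicit.axial_bond_bound`) and — the new kinematic estimate of this file — `|V₀(b + e_ν) − V₀(b)| ≤ α₀η² + Rc₀η³ + (2R + 4R²)α₀²η⁴` (every
bond `b`, every shift `e_ν`), whence `A := (iη)⁻¹ log V₀` has `|A| ≤ 2Rα₀η`, `|∇^ηA| ≤ 2η⁻²(α₀η² + Rc₀η³ + (2R+4R²)α₀²η⁴)`; at `R = M·Lʲ`,
`Lʲη ≤ 1`, `η ≤ 1` this is (3.35) with `O(1)Mα₀ := 2(M+1)α₀ + 2Mc₀ + 4M(1+2M)α₀²` (strictly: any larger `C`).  All [folklore] (lattice gauge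
kinematics; textbook context: axial ∕ tree gauges, e.g. Montvay–Münster *Quantum Fields on a Lattice* §3, Creutz *Quarks, Gluons and Lattices*
ch. 9); the printed sentences above are CONTEXT, not hypotheses.  NOTHING of [4] Thm 3.1 ∕ B8 Thm 4 ∕ Prop 6 is proved or used.

THE MECHANISM (kernel, 0 sorry, 0 def; `𝔸` a complete normed ℂ-algebra with `‖1‖ = 1`, `G ⊇ U(N)` replaced by `U1 𝔸 = {‖u‖, ‖u⁻¹‖ ≤ 1}` as in
`B7Prop1Explicit`; `V₀ := gaugeAct (axialFn V y) V`; the tree contour changes the coordinates in the order `d, d−1, …, 1`).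
§1 unit-norm bookkeeping (`‖aWa⁻¹ − W‖ ≤ 2‖a − 1‖‖W‖`, `‖a⁻¹ − b⁻¹‖ ≤ ‖a − b‖`, …).  §2 gauge invariance of the two radii.  §3 THE SWAP
IDENTITY (any configuration): from the plaquette `V(∂p_{νμ}(x)) = V(x,ν)V(x+e_ν,μ)V(x+e_μ,ν)⁻¹V(x,μ)⁻¹`,
`|V(x+e_ν,μ) − V(x,μ)| ≤ |V(x+e_μ,ν) − V(x,ν)| + α + 2|V(x,ν) − 1|(α + |V(x,μ) − 1|)` (`norm_shift_sub_le_swap`).  §4 TREE BONDS ARE TRIVIAL: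
`V₀(z, κ) = 1` whenever `(z − y)_ι = 0` for all `ι < κ` (`axial_tree_bond`).  §5 PEELING: for `κ < μ` and `x − y` vanishing below `κ`,
`V₀(x,μ) = V₀(∂p_{κμ}(x − e_κ))·V₀(x − e_κ, μ)` and `V₀(x,μ) = V₀(∂p_{κμ}(x))⁻¹·V₀(x + e_κ, μ)` (the tree bonds in the plaquette are `1`), so along
a shift `e_ν`, `ν ≥ μ` (which keeps the vanishing pattern) the bond difference changes by at most `x₁ + 2|x − y|₁α²` per peeling step
(`axial_shift_peel_pos ∕ _neg`), and by induction on `|x − y|₁` (peeling the lowest non-zero coordinate, `exists_lowest_ne_zero`):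
`|V₀(x+e_ν,μ) − V₀(x,μ)| ≤ |x−y|₁·(x₁ + 2Dα²)` for `μ ≤ ν`, `|x − y|₁ ≤ D` (`axial_shift_bound_of_le`); the case `ν < μ` is the swap identity plus
the case `μ < ν`: `axial_shift_bound` — `≤ α + Dx₁ + (2D + 4D²)α²` for ALL `ν, μ`.  §6 (3.35): `reg335Zd_of_plaq_radii` (statement above; the
family `𝒬` is ANY set of pairs `(□, j)` with `Lʲη ≤ 1` and `□` inside an `ℓ¹`-ball of radius `M·Lʲ`; a box of side `r` lattice
units has `ℓ¹`-radius `≤ d·r` about its corner), and `reg335Zd_gaugeAct`: the class (3.35) is invariant under `U1`-valued gauge transformations (compose the gauges).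
HONEST SCOPE.  Sufficient criterion only; (3.36) (second differences) is NOT touched (it would need a bound on second covariant differences of the
plaquette field); constants explicit and not optimised; nothing is inferred from the manuscript beyond the quoted sentences.
-/

namespace Literature.MathematicalPhysics.QuantumFieldTheory.Balaban1983to89.B9Eq335AxialCriterion

open NormedSpace
open B7Prop1Explicit
open B8Eq133Hypotheses (Reg335Zd reg335Zd_iff shiftT byDir byDir_apply shiftT_apply)
open B9Eq39Adjoint (R covD fluct)
open LatticeNorms (scaleLen)
open MatrixLog (mlog exp_mlog norm_mlog_le_two_mul)

noncomputable section

-- `Site` alone would resolve to the torus sites of `Setup.lean`; re-export the `ℤᵈ` sites of `B7Prop1Explicit` (as `B8Eq133Hypotheses` does).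
export B7Prop1Explicit (Site)

variable {d : ℕ}

/-! ## §1 Unit-norm bookkeeping -/

section Units

variable {𝔸 : Type*} [NormedRing 𝔸] [NormOneClass 𝔸]

/-- `‖aWa⁻¹ − W‖ ≤ 2‖a − 1‖·‖W‖` for `a ∈ U1` (`aWa⁻¹ − W = (a − 1)Wa⁻¹ + W(a⁻¹ − 1)`, `‖a⁻¹ − 1‖ ≤ ‖a − 1‖`). [folklore] -/
private theorem norm_conj_sub_self_le {a : 𝔸ˣ} (ha : a ∈ U1 𝔸) (W : 𝔸) :
    ‖(a : 𝔸) * W * ((a⁻¹ : 𝔸ˣ) : 𝔸) - W‖ ≤ 2 * ‖(a : 𝔸) - 1‖ * ‖W‖ := by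
  have h : (a : 𝔸) * W * ((a⁻¹ : 𝔸ˣ) : 𝔸) - W = ((a : 𝔸) - 1) * W * ((a⁻¹ : 𝔸ˣ) : 𝔸) + W * (((a⁻¹ : 𝔸ˣ) : 𝔸) - 1) := by
    noncomm_ring
  rw [h]
  have h1 : ‖((a : 𝔸) - 1) * W * ((a⁻¹ : 𝔸ˣ) : 𝔸)‖ ≤ ‖(a : 𝔸) - 1‖ * ‖W‖ := by
    calc _ ≤ ‖((a : 𝔸) - 1) * W‖ * ‖((a⁻¹ : 𝔸ˣ) : 𝔸)‖ := norm_mul_le _ _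
      _ ≤ ‖((a : 𝔸) - 1) * W‖ * 1 := by gcongr; exact ha.2
      _ ≤ ‖(a : 𝔸) - 1‖ * ‖W‖ := by rw [mul_one]; exact norm_mul_le _ _
  have h2 : ‖W * (((a⁻¹ : 𝔸ˣ) : 𝔸) - 1)‖ ≤ ‖W‖ * ‖(a : 𝔸) - 1‖ :=
    (norm_mul_le _ _).trans (mul_le_mul_of_nonneg_left (norm_inv_sub_one_le ha) (norm_nonneg _))
  calc _ ≤ _ + _ := norm_add_le _ _
    _ ≤ ‖(a : 𝔸) - 1‖ * ‖W‖ + ‖W‖ * ‖(a : 𝔸) - 1‖ := add_le_add h1 h2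
    _ = 2 * ‖(a : 𝔸) - 1‖ * ‖W‖ := by ring

/-- `‖a⁻¹Wa − W‖ ≤ 2‖a − 1‖·‖W‖` for `a ∈ U1`. [folklore] -/
private theorem norm_inv_conj_sub_self_le {a : 𝔸ˣ} (ha : a ∈ U1 𝔸) (W : 𝔸) :
    ‖((a⁻¹ : 𝔸ˣ) : 𝔸) * W * (a : 𝔸) - W‖ ≤ 2 * ‖(a : 𝔸) - 1‖ * ‖W‖ := by
  have h := norm_conj_sub_self_le ((U1 𝔸).inv_mem ha) W
  rw [inv_inv] at h
  exact h.trans (by nlinarith [norm_inv_sub_one_le ha, norm_nonneg W])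

/-- `‖a⁻¹ − b⁻¹‖ ≤ ‖a − b‖` for `a, b ∈ U1` (`a⁻¹ − b⁻¹ = a⁻¹(b − a)b⁻¹`). [folklore] -/
private theorem norm_inv_sub_inv_le {a b : 𝔸ˣ} (ha : a ∈ U1 𝔸) (hb : b ∈ U1 𝔸) :
    ‖((a⁻¹ : 𝔸ˣ) : 𝔸) - ((b⁻¹ : 𝔸ˣ) : 𝔸)‖ ≤ ‖(a : 𝔸) - (b : 𝔸)‖ := by
  have h : ((a⁻¹ : 𝔸ˣ) : 𝔸) - ((b⁻¹ : 𝔸ˣ) : 𝔸) = ((a⁻¹ : 𝔸ˣ) : 𝔸) * ((b : 𝔸) - (a : 𝔸)) * ((b⁻¹ : 𝔸ˣ) : 𝔸) := by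
    rw [mul_sub, sub_mul, Units.inv_mul, one_mul, mul_assoc, Units.mul_inv, mul_one]
  rw [h]
  calc _ ≤ ‖((a⁻¹ : 𝔸ˣ) : 𝔸) * ((b : 𝔸) - (a : 𝔸))‖ * ‖((b⁻¹ : 𝔸ˣ) : 𝔸)‖ := norm_mul_le _ _
    _ ≤ ‖((a⁻¹ : 𝔸ˣ) : 𝔸)‖ * ‖(b : 𝔸) - (a : 𝔸)‖ * 1 := by gcongr; exacts [norm_mul_le _ _, hb.2]
    _ ≤ 1 * ‖(b : 𝔸) - (a : 𝔸)‖ * 1 := by gcongr; exact ha.2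
    _ = ‖(a : 𝔸) - (b : 𝔸)‖ := by rw [one_mul, mul_one, norm_sub_rev]

omit [NormOneClass 𝔸] in
/-- `‖xy − x′y′‖ ≤ ‖x − x′‖ + ‖y − y′‖` when `‖x‖, ‖y′‖ ≤ 1` (`xy − x′y′ = x(y − y′) + (x − x′)y′`). [folklore] -/
private theorem norm_mul_sub_mul_le {x x' y y' : 𝔸} (hx : ‖x‖ ≤ 1) (hy' : ‖y'‖ ≤ 1) :
    ‖x * y - x' * y'‖ ≤ ‖x - x'‖ + ‖y - y'‖ := by
  have h : x * y - x' * y' = x * (y - y') + (x - x') * y' := by noncomm_ring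
  rw [h]
  calc _ ≤ ‖x * (y - y')‖ + ‖(x - x') * y'‖ := norm_add_le _ _
    _ ≤ ‖x‖ * ‖y - y'‖ + ‖x - x'‖ * ‖y'‖ := add_le_add (norm_mul_le _ _) (norm_mul_le _ _)
    _ ≤ 1 * ‖y - y'‖ + ‖x - x'‖ * 1 := by gcongr
    _ = ‖x - x'‖ + ‖y - y'‖ := by ring

/-- `‖aWa⁻¹‖ ≤ ‖W‖` for `a ∈ U1`. [folklore] -/
private theorem norm_conj_le {a : 𝔸ˣ} (ha : a ∈ U1 𝔸) (W : 𝔸) : ‖(a : 𝔸) * W * ((a⁻¹ : 𝔸ˣ) : 𝔸)‖ ≤ ‖W‖ := by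
  calc _ ≤ ‖(a : 𝔸) * W‖ * ‖((a⁻¹ : 𝔸ˣ) : 𝔸)‖ := norm_mul_le _ _
    _ ≤ ‖(a : 𝔸)‖ * ‖W‖ * 1 := by gcongr; exacts [norm_mul_le _ _, ha.2]
    _ ≤ 1 * ‖W‖ * 1 := by gcongr; exact ha.1
    _ = ‖W‖ := by ring

/-- The norm of a `U1` unit is `≤ 1`. [folklore] -/
private theorem norm_le_one_of_mem {a : 𝔸ˣ} (ha : a ∈ U1 𝔸) : ‖(a : 𝔸)‖ ≤ 1 := ha.1

end Units

/-! ## §2 The two radii and their gauge invariance -/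

section Radii

variable {𝔸 : Type*} [NormedRing 𝔸] [NormOneClass 𝔸]

/-- The plaquette radius is gauge invariant: `|V^u(∂p) − 1| = |u(x)V(∂p)u(x)⁻¹ − 1| ≤ |V(∂p) − 1|` for `U1`-valued `u` (B7 (45)
«|V₀(∂p) − 1| = |V(∂p) − 1|»). [cite: Balaban1985Averaging, (45) p.24] -/
theorem plaq_bound_gaugeAct {V : Site d → Fin d → 𝔸ˣ} {u : Site d → 𝔸ˣ} (hu : ∀ x, u x ∈ U1 𝔸) {α : ℝ}
    (h44 : ∀ (x : Site d) (κ μ : Fin d), κ ≠ μ → ‖((hol V x (plaqWord κ μ) : 𝔸ˣ) : 𝔸) - 1‖ ≤ α)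
    (x : Site d) (κ μ : Fin d) (hκμ : κ ≠ μ) :
    ‖((hol (gaugeAct u V) x (plaqWord κ μ) : 𝔸ˣ) : 𝔸) - 1‖ ≤ α := by
  rw [hol_gaugeAct_closed _ _ _ _ (disp_plaqWord κ μ), Units.val_mul, Units.val_mul]
  exact (norm_units_conj_sub_one_le (hu x) _).trans (h44 x κ μ hκμ)

/-- The transported plaquette-gradient radius is gauge invariant: `R(V^u(b))V^u(∂(p+b)) − V^u(∂p) = u(x)[R(V(b))V(∂(p+b)) − V(∂p)]u(x)⁻¹`.
[folklore] -/
private theorem plaqGrad_bound_gaugeAct {V : Site d → Fin d → 𝔸ˣ} {u : Site d → 𝔸ˣ} (hu : ∀ x, u x ∈ U1 𝔸) {x₁ : ℝ}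
    (hG : ∀ (p : Site d) (ν κ μ : Fin d), κ ≠ μ →
      ‖(V p ν : 𝔸) * ((hol V (p + e ν) (plaqWord κ μ) : 𝔸ˣ) : 𝔸) * (((V p ν)⁻¹ : 𝔸ˣ) : 𝔸)
        - ((hol V p (plaqWord κ μ) : 𝔸ˣ) : 𝔸)‖ ≤ x₁)
    (p : Site d) (ν κ μ : Fin d) (hκμ : κ ≠ μ) :
    ‖((gaugeAct u V p ν : 𝔸ˣ) : 𝔸) * ((hol (gaugeAct u V) (p + e ν) (plaqWord κ μ) : 𝔸ˣ) : 𝔸) * (((gaugeAct u V p ν)⁻¹ : 𝔸ˣ) : 𝔸)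
        - ((hol (gaugeAct u V) p (plaqWord κ μ) : 𝔸ˣ) : 𝔸)‖ ≤ x₁ := by
  have h1 : (gaugeAct u V p ν * hol (gaugeAct u V) (p + e ν) (plaqWord κ μ) * (gaugeAct u V p ν)⁻¹ : 𝔸ˣ) =
      u p * (V p ν * hol V (p + e ν) (plaqWord κ μ) * (V p ν)⁻¹) * (u p)⁻¹ := by
    rw [hol_gaugeAct_closed _ _ _ _ (disp_plaqWord κ μ)]
    simp only [gaugeAct, mul_inv_rev, inv_inv, mul_assoc, inv_mul_cancel_left]
  have h2 : (hol (gaugeAct u V) p (plaqWord κ μ) : 𝔸ˣ) = u p * hol V p (plaqWord κ μ) * (u p)⁻¹ :=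
    hol_gaugeAct_closed _ _ _ _ (disp_plaqWord κ μ)
  have h3 : ((gaugeAct u V p ν : 𝔸ˣ) : 𝔸) * ((hol (gaugeAct u V) (p + e ν) (plaqWord κ μ) : 𝔸ˣ) : 𝔸) * (((gaugeAct u V p ν)⁻¹ : 𝔸ˣ) : 𝔸)
        - ((hol (gaugeAct u V) p (plaqWord κ μ) : 𝔸ˣ) : 𝔸) =
      (u p : 𝔸) * ((V p ν : 𝔸) * ((hol V (p + e ν) (plaqWord κ μ) : 𝔸ˣ) : 𝔸) * (((V p ν)⁻¹ : 𝔸ˣ) : 𝔸)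
        - ((hol V p (plaqWord κ μ) : 𝔸ˣ) : 𝔸)) * (((u p)⁻¹ : 𝔸ˣ) : 𝔸) := by
    have e1 : ((gaugeAct u V p ν : 𝔸ˣ) : 𝔸) * ((hol (gaugeAct u V) (p + e ν) (plaqWord κ μ) : 𝔸ˣ) : 𝔸) *
          (((gaugeAct u V p ν)⁻¹ : 𝔸ˣ) : 𝔸) =
        ((gaugeAct u V p ν * hol (gaugeAct u V) (p + e ν) (plaqWord κ μ) * (gaugeAct u V p ν)⁻¹ : 𝔸ˣ) : 𝔸) := by
      simp only [Units.val_mul]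
    rw [e1, h1, h2]
    simp only [Units.val_mul]
    noncomm_ring
  rw [h3]
  exact (norm_conj_le (hu p) _).trans (hG p ν κ μ hκμ)

/-! ## §3 The swap identity -/

/-- **THE SWAP IDENTITY** (any `U1`-valued configuration with plaquettes within `α` of `1`): for `ν ≠ μ`,
`|V(x+e_ν, μ) − V(x, μ)| ≤ |V(x+e_μ, ν) − V(x, ν)| + α + 2|V(x,ν) − 1|·(α + |V(x,μ) − 1|)` — from
`V(x+e_ν,μ) = V(x,ν)⁻¹·V(∂p_{νμ}(x))·V(x,μ)·V(x+e_μ,ν)`. [folklore] -/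
private theorem norm_shift_sub_le_swap {V : Site d → Fin d → 𝔸ˣ} (hV : ∀ x κ, V x κ ∈ U1 𝔸) {α : ℝ}
    (h44 : ∀ (x : Site d) (κ μ : Fin d), κ ≠ μ → ‖((hol V x (plaqWord κ μ) : 𝔸ˣ) : 𝔸) - 1‖ ≤ α)
    (x : Site d) {ν μ : Fin d} (hνμ : ν ≠ μ) :
    ‖(V (x + e ν) μ : 𝔸) - (V x μ : 𝔸)‖ ≤
      ‖(V (x + e μ) ν : 𝔸) - (V x ν : 𝔸)‖ + α + 2 * ‖(V x ν : 𝔸) - 1‖ * (α + ‖(V x μ : 𝔸) - 1‖) := by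
  -- letters: `a = V(x,ν)`, `b = V(x,μ)`, `b′ = V(x+e_ν,μ)`, `c = V(x+e_μ,ν)`, `P = V(∂p_{νμ}(x))`
  obtain ⟨a, ha⟩ : ∃ a : 𝔸ˣ, a = V x ν := ⟨_, rfl⟩
  obtain ⟨b, hb⟩ : ∃ b : 𝔸ˣ, b = V x μ := ⟨_, rfl⟩
  obtain ⟨b', hb'⟩ : ∃ b' : 𝔸ˣ, b' = V (x + e ν) μ := ⟨_, rfl⟩
  obtain ⟨c, hc⟩ : ∃ c : 𝔸ˣ, c = V (x + e μ) ν := ⟨_, rfl⟩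
  obtain ⟨P, hP⟩ : ∃ P : 𝔸ˣ, P = hol V x (plaqWord ν μ) := ⟨_, rfl⟩
  have hPeq : P = a * b' * c⁻¹ * b⁻¹ := by
    rw [hP, ← lplaqWord_true, hol_lplaqWord]
    simp only [stepHol_true, Letter.vec_true, ha, hb, hb', hc]
  have hb'eq : b' = a⁻¹ * P * b * c := by rw [hPeq]; group
  have hPm : P ∈ U1 𝔸 := hP ▸ hol_mem hV _ _
  have ham : a ∈ U1 𝔸 := ha ▸ hV _ _
  have hbm : b ∈ U1 𝔸 := hb ▸ hV _ _
  have hcm : c ∈ U1 𝔸 := hc ▸ hV _ _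
  have hP1 : ‖(P : 𝔸) - 1‖ ≤ α := hP ▸ h44 x ν μ hνμ
  rw [← hb', ← hb, ← hc, ← ha]
  -- `b' − b = a⁻¹Pb(c − a) + (a⁻¹(Pb)a − Pb) + (P − 1)b`
  have hdec : (b' : 𝔸) - (b : 𝔸) =
      ((a⁻¹ : 𝔸ˣ) : 𝔸) * (P : 𝔸) * (b : 𝔸) * ((c : 𝔸) - (a : 𝔸)) +
        ((((a⁻¹ : 𝔸ˣ) : 𝔸) * ((P : 𝔸) * (b : 𝔸)) * (a : 𝔸) - (P : 𝔸) * (b : 𝔸)) + ((P : 𝔸) - 1) * (b : 𝔸)) := by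
    rw [hb'eq]; push_cast; noncomm_ring
  have h1 : ‖((a⁻¹ : 𝔸ˣ) : 𝔸) * (P : 𝔸) * (b : 𝔸) * ((c : 𝔸) - (a : 𝔸))‖ ≤ ‖(c : 𝔸) - (a : 𝔸)‖ := by
    have hn : ‖((a⁻¹ : 𝔸ˣ) : 𝔸) * (P : 𝔸) * (b : 𝔸)‖ ≤ 1 := by
      have := (U1 𝔸).mul_mem ((U1 𝔸).mul_mem ((U1 𝔸).inv_mem ham) hPm) hbm
      simpa only [Units.val_mul] using this.1
    calc _ ≤ ‖((a⁻¹ : 𝔸ˣ) : 𝔸) * (P : 𝔸) * (b : 𝔸)‖ * ‖(c : 𝔸) - (a : 𝔸)‖ := norm_mul_le _ _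
      _ ≤ 1 * ‖(c : 𝔸) - (a : 𝔸)‖ := by gcongr
      _ = _ := one_mul _
  have hPb : ‖(P : 𝔸) * (b : 𝔸) - 1‖ ≤ α + ‖(b : 𝔸) - 1‖ :=
    (B8Ineq170.norm_mul_sub_one_le_of_norm_le_one hPm.1).trans (add_le_add hP1 le_rfl)
  have h2 : ‖((a⁻¹ : 𝔸ˣ) : 𝔸) * ((P : 𝔸) * (b : 𝔸)) * (a : 𝔸) - (P : 𝔸) * (b : 𝔸)‖ ≤
      2 * ‖(a : 𝔸) - 1‖ * (α + ‖(b : 𝔸) - 1‖) := by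
    have hw : ((a⁻¹ : 𝔸ˣ) : 𝔸) * ((P : 𝔸) * (b : 𝔸)) * (a : 𝔸) - (P : 𝔸) * (b : 𝔸) =
        ((a⁻¹ : 𝔸ˣ) : 𝔸) * ((P : 𝔸) * (b : 𝔸) - 1) * (a : 𝔸) - ((P : 𝔸) * (b : 𝔸) - 1) := by
      rw [mul_sub, sub_mul, mul_one, Units.inv_mul]; abel
    rw [hw]
    exact (norm_inv_conj_sub_self_le ham _).trans (mul_le_mul_of_nonneg_left hPb (by positivity))
  have h3 : ‖((P : 𝔸) - 1) * (b : 𝔸)‖ ≤ α := by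
    calc _ ≤ ‖(P : 𝔸) - 1‖ * ‖(b : 𝔸)‖ := norm_mul_le _ _
      _ ≤ α * 1 := mul_le_mul hP1 hbm.1 (norm_nonneg _) ((norm_nonneg _).trans hP1)
      _ = α := mul_one α
  rw [hdec]
  calc _ ≤ ‖((a⁻¹ : 𝔸ˣ) : 𝔸) * (P : 𝔸) * (b : 𝔸) * ((c : 𝔸) - (a : 𝔸))‖ +
        ‖(((a⁻¹ : 𝔸ˣ) : 𝔸) * ((P : 𝔸) * (b : 𝔸)) * (a : 𝔸) - (P : 𝔸) * (b : 𝔸)) + ((P : 𝔸) - 1) * (b : 𝔸)‖ := norm_add_le _ _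
    _ ≤ ‖(c : 𝔸) - (a : 𝔸)‖ + (2 * ‖(a : 𝔸) - 1‖ * (α + ‖(b : 𝔸) - 1‖) + α) :=
        add_le_add h1 ((norm_add_le _ _).trans (add_le_add h2 h3))
    _ = _ := by ring

end Radii

/-! ## §4 The complete axial gauge of [Balaban1985Averaging] p. 24: tree bonds are trivial -/

section Tree

variable {G : Type*} [Group G]

/-- Shifting a site by a multiple of `e_{κ′}`, `κ ≤ κ′`, does not change its coordinates below `κ`. [folklore] -/
private theorem shift_apply_of_lt {x y : Site d} {κ κ' : Fin d} (hκ : κ ≤ κ') (n : ℤ) {ι : Fin d} (hι : ι < κ) :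
    (x + n • e κ' - y) ι = (x - y) ι := by
  have hne : ι ≠ κ' := fun h => absurd (h ▸ hι) (not_lt.mpr hκ)
  simp [e_apply, hne]

/-- The vanishing pattern «`(x − y)_ι = 0` for all `ι < κ`» is stable under shifts by `±e_{κ′}`, `κ ≤ κ′`. [folklore] -/
private theorem lowerZero_shift {x y : Site d} {κ κ' : Fin d} (hκ : κ ≤ κ') (hx : ∀ ι, ι < κ → (x - y) ι = 0) (n : ℤ) :
    ∀ ι, ι < κ → (x + n • e κ' - y) ι = 0 :=
  fun ι hι => (shift_apply_of_lt hκ n hι).trans (hx ι hι)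

/-- **TREE BONDS ARE TRIVIAL IN THE COMPLETE AXIAL GAUGE** («the conditions V₀(Γ_{y,x}) = 1 imply V₀(x, x + e₁) = 1», B7 p. 25 — for the
tree contour changing the coordinates in the order `d, d−1, …, 1`): if `(z − y)_ι = 0` for every direction `ι < κ` (the coordinates the contour
`Γ_{y,·}` changes AFTER `κ`), then the bond `⟨z, z + e_κ⟩` lies on the contour `Γ_{y, z + e_κ}` (or `Γ_{y,z}`), so `V₀(z, z + e_κ) = 1` for
`V₀ = V^{v₀}`, `v₀ = axialFn V y`. [cite: Balaban1985Averaging, pp.24–25] -/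
theorem axial_tree_bond (V : Site d → Fin d → G) (y z : Site d) (κ : Fin d) (hz : ∀ ι, ι < κ → (z - y) ι = 0) :
    gaugeAct (axialFn V y) V z κ = 1 := by
  obtain ⟨s, t, hst⟩ := List.append_of_mem (a := κ) (l := (List.finRange d).reverse) (by simp)
  have hsorted : ((List.finRange d).reverse).Pairwise (fun a b => b < a) :=
    List.pairwise_reverse.mpr (List.pairwise_lt_finRange d)
  rw [hst] at hsorted
  obtain ⟨-, hκt, hst'⟩ := List.pairwise_append.1 hsorted
  have ht : ∀ ι ∈ t, ι < κ := (List.pairwise_cons.1 hκt).1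
  have hs : ∀ ι ∈ s, κ < ι := fun ι hι => hst' ι hι κ (by simp)
  -- the tree words of `v = z − y` and of `v + e_κ`
  have hft : t.flatMap (fun ι => seg ι ((z - y) ι)) = [] :=
    List.flatMap_eq_nil_iff.2 fun ι hι => by rw [hz ι (ht ι hι), seg_zero]
  have hft' : t.flatMap (fun ι => seg ι ((z - y + e κ) ι)) = [] :=
    List.flatMap_eq_nil_iff.2 fun ι hι => by
      have hne : ι ≠ κ := (ht ι hι).ne
      rw [show (z - y + e κ) ι = (z - y) ι by simp [e_apply, hne], hz ι (ht ι hι), seg_zero]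
  have hfs : s.flatMap (fun ι => seg ι ((z - y + e κ) ι)) = s.flatMap (fun ι => seg ι ((z - y) ι)) :=
    flatMap_congr_of fun ι hι => by
      have hne : ι ≠ κ := (hs ι hι).ne'
      rw [show (z - y + e κ) ι = (z - y) ι by simp [e_apply, hne]]
  have hκκ : seg κ ((z - y + e κ) κ) = seg κ ((z - y) κ + 1) := by simp [e_apply]
  have h1 : treeWord (z - y) = s.flatMap (fun ι => seg ι ((z - y) ι)) ++ seg κ ((z - y) κ) := by
    rw [treeWord, hst, List.flatMap_append, List.flatMap_cons, hft, List.append_nil]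
  have h2 : treeWord (z - y + e κ) = s.flatMap (fun ι => seg ι ((z - y) ι)) ++ seg κ ((z - y) κ + 1) := by
    rw [treeWord, hst, List.flatMap_append, List.flatMap_cons, hft', List.append_nil, hfs, hκκ]
  have ht1 := hol_axial_treeWord V y (z - y)
  have ht2 := hol_axial_treeWord V y (z - y + e κ)
  rw [h1, hol_append] at ht1
  rw [h2, hol_append, hol_seg_succ, ← mul_assoc, ht1, one_mul] at ht2
  have hz' : y + disp (s.flatMap (fun ι => seg ι ((z - y) ι))) + (z - y) κ • e κ = z := by
    have hd := disp_treeWord (z - y)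
    rw [h1, disp_append, disp_seg] at hd
    rw [add_assoc, hd, add_sub_cancel]
  rwa [hz'] at ht2

/-- **PEELING, POSITIVE SIDE**: for `κ < μ` and `x − y` vanishing below `κ`, the plaquette `p_{κμ}(x − e_κ)` has its two `e_κ`-bonds on the
tree, so `V₀(x, μ) = V₀(∂p_{κμ}(x − e_κ)) · V₀(x − e_κ, μ)`. [folklore] -/
private theorem axial_peel_pos (V : Site d → Fin d → G) (y x : Site d) {κ μ : Fin d} (hκμ : κ < μ)
    (hx : ∀ ι, ι < κ → (x - y) ι = 0) :
    gaugeAct (axialFn V y) V x μ =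
      hol (gaugeAct (axialFn V y) V) (x - e κ) (plaqWord κ μ) * gaugeAct (axialFn V y) V (x - e κ) μ := by
  have hp : ∀ ι, ι < κ → (x - e κ - y) ι = 0 := by
    simpa only [neg_smul, one_smul, ← sub_eq_add_neg] using lowerZero_shift le_rfl hx (-1)
  have hq : ∀ ι, ι < κ → (x - e κ + e μ - y) ι = 0 := by
    simpa only [one_smul] using lowerZero_shift hκμ.le hp 1
  have h1 : gaugeAct (axialFn V y) V (x - e κ) κ = 1 := axial_tree_bond V y _ κ hp
  have h2 : gaugeAct (axialFn V y) V (x - e κ + e μ) κ = 1 := axial_tree_bond V y _ κ hq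
  rw [← lplaqWord_true, hol_lplaqWord]
  simp only [stepHol_true, Letter.vec_true, sub_add_cancel, h1, h2, inv_one, mul_one, one_mul, inv_mul_cancel_right]

/-- **PEELING, NEGATIVE SIDE**: for `κ < μ` and `x − y` vanishing below `κ`, the plaquette `p_{κμ}(x)` has its two `e_κ`-bonds on the tree, so
`V₀(x, μ) = V₀(∂p_{κμ}(x))⁻¹ · V₀(x + e_κ, μ)`. [folklore] -/
private theorem axial_peel_neg (V : Site d → Fin d → G) (y x : Site d) {κ μ : Fin d} (hκμ : κ < μ)
    (hx : ∀ ι, ι < κ → (x - y) ι = 0) :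
    gaugeAct (axialFn V y) V x μ =
      (hol (gaugeAct (axialFn V y) V) x (plaqWord κ μ))⁻¹ * gaugeAct (axialFn V y) V (x + e κ) μ := by
  have hq : ∀ ι, ι < κ → (x + e μ - y) ι = 0 := by
    simpa only [one_smul] using lowerZero_shift hκμ.le hx 1
  have h1 : gaugeAct (axialFn V y) V x κ = 1 := axial_tree_bond V y _ κ hx
  have h2 : gaugeAct (axialFn V y) V (x + e μ) κ = 1 := axial_tree_bond V y _ κ hq
  rw [← lplaqWord_true, hol_lplaqWord]
  simp only [stepHol_true, Letter.vec_true, h1, h2, inv_one, mul_one, one_mul, mul_inv_rev, inv_inv, inv_mul_cancel_right]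

/-- The lowest direction in which `v` does not vanish below `μ`. [folklore] -/
private theorem exists_lowest_ne_zero {v : Site d} {μ : Fin d} (h : ¬ ∀ ι, ι < μ → v ι = 0) :
    ∃ κ, κ < μ ∧ v κ ≠ 0 ∧ ∀ ι, ι < κ → v ι = 0 := by
  classical
  push Not at h
  obtain ⟨ι₀, hι₀, hv₀⟩ := h
  set S : Finset (Fin d) := Finset.univ.filter fun ι => ι < μ ∧ v ι ≠ 0 with hS
  have hne : S.Nonempty := ⟨ι₀, by simp [hS, hι₀, hv₀]⟩
  have hmem := Finset.min'_mem S hne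
  simp only [hS, Finset.mem_filter, Finset.mem_univ, true_and] at hmem
  refine ⟨S.min' hne, hmem.1, hmem.2, fun ι hι => ?_⟩
  by_contra hv
  have hιS : ι ∈ S := by simp [hS, hι.trans hmem.1, hv]
  exact absurd (Finset.min'_le S ι hιS) (not_le.mpr hι)

/-- `|v − e_κ|₁ + 1 = |v|₁` when `v_κ > 0`. [folklore] -/
private theorem l1_sub_e_add_one {v : Site d} {κ : Fin d} (h : 0 < v κ) : l1 (v - e κ) + 1 = l1 v := by
  unfold l1
  rw [← Finset.add_sum_erase _ _ (Finset.mem_univ κ), ← Finset.add_sum_erase _ (fun ι => (v ι).natAbs) (Finset.mem_univ κ)]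
  have hrest : ∑ ι ∈ Finset.univ.erase κ, ((v - e κ) ι).natAbs = ∑ ι ∈ Finset.univ.erase κ, (v ι).natAbs :=
    Finset.sum_congr rfl fun ι hι => by rw [show (v - e κ) ι = v ι by simp [e_apply, Finset.ne_of_mem_erase hι]]
  rw [hrest, show (v - e κ) κ = v κ - 1 by simp [e_apply]]
  omega

/-- `|v + e_κ|₁ + 1 = |v|₁` when `v_κ < 0`. [folklore] -/
private theorem l1_add_e_add_one {v : Site d} {κ : Fin d} (h : v κ < 0) : l1 (v + e κ) + 1 = l1 v := by
  unfold l1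
  rw [← Finset.add_sum_erase _ _ (Finset.mem_univ κ), ← Finset.add_sum_erase _ (fun ι => (v ι).natAbs) (Finset.mem_univ κ)]
  have hrest : ∑ ι ∈ Finset.univ.erase κ, ((v + e κ) ι).natAbs = ∑ ι ∈ Finset.univ.erase κ, (v ι).natAbs :=
    Finset.sum_congr rfl fun ι hι => by rw [show (v + e κ) ι = v ι by simp [e_apply, Finset.ne_of_mem_erase hι]]
  rw [hrest, show (v + e κ) κ = v κ + 1 by simp [e_apply]]
  omega

/-- `|v|₁ = 0` forces `v = 0`. [folklore] -/
private theorem eq_zero_of_l1_eq_zero {v : Site d} (h : l1 v = 0) (ι : Fin d) : v ι = 0 := by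
  unfold l1 at h
  have := (Finset.sum_eq_zero_iff.1 h) ι (Finset.mem_univ ι)
  exact Int.natAbs_eq_zero.1 this

end Tree

/-! ## §5 The bond gradient in the axial gauge -/

section Gradient

variable {𝔸 : Type*} [NormedRing 𝔸] [NormOneClass 𝔸]

/-- **ONE PEELING STEP, POSITIVE SIDE** (shift `e_ν`, `ν ≥ μ > κ`, `x − y` vanishing below `κ`): the shifted and unshifted peeling identities
differ by the transported plaquette gradient `x₁` plus a transport defect `2|x − e_κ − y|₁α·α`:
`|V₀(x+e_ν,μ) − V₀(x,μ)| ≤ |V₀(x−e_κ+e_ν,μ) − V₀(x−e_κ,μ)| + x₁ + 2|x−e_κ−y|₁α²`. [folklore] -/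
private theorem axial_shift_peel_pos {V : Site d → Fin d → 𝔸ˣ} (hV : ∀ x κ, V x κ ∈ U1 𝔸) {α x₁ : ℝ} (hα : 0 ≤ α)
    (h44 : ∀ (x : Site d) (κ μ : Fin d), κ ≠ μ → ‖((hol V x (plaqWord κ μ) : 𝔸ˣ) : 𝔸) - 1‖ ≤ α)
    (hG : ∀ (p : Site d) (ν κ μ : Fin d), κ ≠ μ →
      ‖(V p ν : 𝔸) * ((hol V (p + e ν) (plaqWord κ μ) : 𝔸ˣ) : 𝔸) * (((V p ν)⁻¹ : 𝔸ˣ) : 𝔸)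
        - ((hol V p (plaqWord κ μ) : 𝔸ˣ) : 𝔸)‖ ≤ x₁)
    (y x : Site d) {κ μ ν : Fin d} (hκμ : κ < μ) (hμν : μ ≤ ν) (hx : ∀ ι, ι < κ → (x - y) ι = 0) :
    ‖((gaugeAct (axialFn V y) V (x + e ν) μ : 𝔸ˣ) : 𝔸) - ((gaugeAct (axialFn V y) V x μ : 𝔸ˣ) : 𝔸)‖ ≤
      ‖((gaugeAct (axialFn V y) V (x - e κ + e ν) μ : 𝔸ˣ) : 𝔸) - ((gaugeAct (axialFn V y) V (x - e κ) μ : 𝔸ˣ) : 𝔸)‖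
        + (x₁ + 2 * ((l1 (x - e κ - y) : ℝ) * α) * α) := by
  have hu : ∀ z, axialFn V y z ∈ U1 𝔸 := axialFn_mem hV y
  have hV₀ : ∀ z κ, gaugeAct (axialFn V y) V z κ ∈ U1 𝔸 := gaugeAct_mem hV hu
  have hx' : ∀ ι, ι < κ → (x + e ν - y) ι = 0 := by
    simpa only [one_smul] using lowerZero_shift (hκμ.le.trans hμν) hx 1
  have e1 := axial_peel_pos V y x hκμ hx
  have e2 := axial_peel_pos V y (x + e ν) hκμ hx'
  rw [show x + e ν - e κ = x - e κ + e ν by abel] at e2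
  -- letters
  have hPm : hol (gaugeAct (axialFn V y) V) (x - e κ) (plaqWord κ μ) ∈ U1 𝔸 := hol_mem hV₀ _ _
  have hP'm : hol (gaugeAct (axialFn V y) V) (x - e κ + e ν) (plaqWord κ μ) ∈ U1 𝔸 := hol_mem hV₀ _ _
  have ham : gaugeAct (axialFn V y) V (x - e κ) ν ∈ U1 𝔸 := hV₀ _ _
  have hP'1 : ‖((hol (gaugeAct (axialFn V y) V) (x - e κ + e ν) (plaqWord κ μ) : 𝔸ˣ) : 𝔸) - 1‖ ≤ α :=
    plaq_bound_gaugeAct hu h44 _ κ μ hκμ.ne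
  have hgrad := plaqGrad_bound_gaugeAct hu hG (x - e κ) ν κ μ hκμ.ne
  have hbond : ‖((gaugeAct (axialFn V y) V (x - e κ) ν : 𝔸ˣ) : 𝔸) - 1‖ ≤ (l1 (x - e κ - y) : ℝ) * α :=
    axial_bond_bound V hV y h44 hα (x - e κ) ν
  -- `‖P′ − P‖ ≤ x₁ + 2|x−e_κ−y|₁α·α`
  have hPP : ‖((hol (gaugeAct (axialFn V y) V) (x - e κ + e ν) (plaqWord κ μ) : 𝔸ˣ) : 𝔸)
      - ((hol (gaugeAct (axialFn V y) V) (x - e κ) (plaqWord κ μ) : 𝔸ˣ) : 𝔸)‖ ≤ x₁ + 2 * ((l1 (x - e κ - y) : ℝ) * α) * α := by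
    have hconj := norm_conj_sub_self_le ham
      (((hol (gaugeAct (axialFn V y) V) (x - e κ + e ν) (plaqWord κ μ) : 𝔸ˣ) : 𝔸) - 1)
    have hrw : ((gaugeAct (axialFn V y) V (x - e κ) ν : 𝔸ˣ) : 𝔸) *
          (((hol (gaugeAct (axialFn V y) V) (x - e κ + e ν) (plaqWord κ μ) : 𝔸ˣ) : 𝔸) - 1) *
          (((gaugeAct (axialFn V y) V (x - e κ) ν)⁻¹ : 𝔸ˣ) : 𝔸) -
          (((hol (gaugeAct (axialFn V y) V) (x - e κ + e ν) (plaqWord κ μ) : 𝔸ˣ) : 𝔸) - 1) =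
        ((gaugeAct (axialFn V y) V (x - e κ) ν : 𝔸ˣ) : 𝔸) *
          ((hol (gaugeAct (axialFn V y) V) (x - e κ + e ν) (plaqWord κ μ) : 𝔸ˣ) : 𝔸) *
          (((gaugeAct (axialFn V y) V (x - e κ) ν)⁻¹ : 𝔸ˣ) : 𝔸) -
          ((hol (gaugeAct (axialFn V y) V) (x - e κ + e ν) (plaqWord κ μ) : 𝔸ˣ) : 𝔸) := by
      rw [mul_sub, sub_mul, mul_one, Units.mul_inv]; abel
    rw [hrw] at hconj
    have htri := norm_sub_le_norm_sub_add_norm_sub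
      (((hol (gaugeAct (axialFn V y) V) (x - e κ + e ν) (plaqWord κ μ) : 𝔸ˣ) : 𝔸))
      (((gaugeAct (axialFn V y) V (x - e κ) ν : 𝔸ˣ) : 𝔸) *
          ((hol (gaugeAct (axialFn V y) V) (x - e κ + e ν) (plaqWord κ μ) : 𝔸ˣ) : 𝔸) *
          (((gaugeAct (axialFn V y) V (x - e κ) ν)⁻¹ : 𝔸ˣ) : 𝔸))
      (((hol (gaugeAct (axialFn V y) V) (x - e κ) (plaqWord κ μ) : 𝔸ˣ) : 𝔸))
    have h2 : 2 * ‖((gaugeAct (axialFn V y) V (x - e κ) ν : 𝔸ˣ) : 𝔸) - 1‖ *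
        ‖((hol (gaugeAct (axialFn V y) V) (x - e κ + e ν) (plaqWord κ μ) : 𝔸ˣ) : 𝔸) - 1‖ ≤
        2 * ((l1 (x - e κ - y) : ℝ) * α) * α := by gcongr
    rw [norm_sub_rev] at hconj
    linarith
  rw [e1, e2, Units.val_mul, Units.val_mul]
  calc _ ≤ _ + _ := norm_mul_sub_mul_le hP'm.1 (hV₀ _ _).1
    _ ≤ _ := by linarith

/-- **ONE PEELING STEP, NEGATIVE SIDE**: `|V₀(x+e_ν,μ) − V₀(x,μ)| ≤ |V₀(x+e_κ+e_ν,μ) − V₀(x+e_κ,μ)| + x₁ + 2|x−y|₁α²`. [folklore] -/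
private theorem axial_shift_peel_neg {V : Site d → Fin d → 𝔸ˣ} (hV : ∀ x κ, V x κ ∈ U1 𝔸) {α x₁ : ℝ} (hα : 0 ≤ α)
    (h44 : ∀ (x : Site d) (κ μ : Fin d), κ ≠ μ → ‖((hol V x (plaqWord κ μ) : 𝔸ˣ) : 𝔸) - 1‖ ≤ α)
    (hG : ∀ (p : Site d) (ν κ μ : Fin d), κ ≠ μ →
      ‖(V p ν : 𝔸) * ((hol V (p + e ν) (plaqWord κ μ) : 𝔸ˣ) : 𝔸) * (((V p ν)⁻¹ : 𝔸ˣ) : 𝔸)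
        - ((hol V p (plaqWord κ μ) : 𝔸ˣ) : 𝔸)‖ ≤ x₁)
    (y x : Site d) {κ μ ν : Fin d} (hκμ : κ < μ) (hμν : μ ≤ ν) (hx : ∀ ι, ι < κ → (x - y) ι = 0) :
    ‖((gaugeAct (axialFn V y) V (x + e ν) μ : 𝔸ˣ) : 𝔸) - ((gaugeAct (axialFn V y) V x μ : 𝔸ˣ) : 𝔸)‖ ≤
      ‖((gaugeAct (axialFn V y) V (x + e κ + e ν) μ : 𝔸ˣ) : 𝔸) - ((gaugeAct (axialFn V y) V (x + e κ) μ : 𝔸ˣ) : 𝔸)‖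
        + (x₁ + 2 * ((l1 (x - y) : ℝ) * α) * α) := by
  have hu : ∀ z, axialFn V y z ∈ U1 𝔸 := axialFn_mem hV y
  have hV₀ : ∀ z κ, gaugeAct (axialFn V y) V z κ ∈ U1 𝔸 := gaugeAct_mem hV hu
  have hx' : ∀ ι, ι < κ → (x + e ν - y) ι = 0 := by
    simpa only [one_smul] using lowerZero_shift (hκμ.le.trans hμν) hx 1
  have e1 := axial_peel_neg V y x hκμ hx
  have e2 := axial_peel_neg V y (x + e ν) hκμ hx'
  rw [show x + e ν + e κ = x + e κ + e ν by abel] at e2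
  have hPm : hol (gaugeAct (axialFn V y) V) x (plaqWord κ μ) ∈ U1 𝔸 := hol_mem hV₀ _ _
  have hP'm : hol (gaugeAct (axialFn V y) V) (x + e ν) (plaqWord κ μ) ∈ U1 𝔸 := hol_mem hV₀ _ _
  have ham : gaugeAct (axialFn V y) V x ν ∈ U1 𝔸 := hV₀ _ _
  have hP'1 : ‖((hol (gaugeAct (axialFn V y) V) (x + e ν) (plaqWord κ μ) : 𝔸ˣ) : 𝔸) - 1‖ ≤ α :=
    plaq_bound_gaugeAct hu h44 _ κ μ hκμ.ne
  have hgrad := plaqGrad_bound_gaugeAct hu hG x ν κ μ hκμ.ne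
  have hbond : ‖((gaugeAct (axialFn V y) V x ν : 𝔸ˣ) : 𝔸) - 1‖ ≤ (l1 (x - y) : ℝ) * α :=
    axial_bond_bound V hV y h44 hα x ν
  have hPP : ‖((hol (gaugeAct (axialFn V y) V) (x + e ν) (plaqWord κ μ) : 𝔸ˣ) : 𝔸)
      - ((hol (gaugeAct (axialFn V y) V) x (plaqWord κ μ) : 𝔸ˣ) : 𝔸)‖ ≤ x₁ + 2 * ((l1 (x - y) : ℝ) * α) * α := by
    have hconj := norm_conj_sub_self_le ham
      (((hol (gaugeAct (axialFn V y) V) (x + e ν) (plaqWord κ μ) : 𝔸ˣ) : 𝔸) - 1)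
    have hrw : ((gaugeAct (axialFn V y) V x ν : 𝔸ˣ) : 𝔸) *
          (((hol (gaugeAct (axialFn V y) V) (x + e ν) (plaqWord κ μ) : 𝔸ˣ) : 𝔸) - 1) *
          (((gaugeAct (axialFn V y) V x ν)⁻¹ : 𝔸ˣ) : 𝔸) -
          (((hol (gaugeAct (axialFn V y) V) (x + e ν) (plaqWord κ μ) : 𝔸ˣ) : 𝔸) - 1) =
        ((gaugeAct (axialFn V y) V x ν : 𝔸ˣ) : 𝔸) *
          ((hol (gaugeAct (axialFn V y) V) (x + e ν) (plaqWord κ μ) : 𝔸ˣ) : 𝔸) *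
          (((gaugeAct (axialFn V y) V x ν)⁻¹ : 𝔸ˣ) : 𝔸) -
          ((hol (gaugeAct (axialFn V y) V) (x + e ν) (plaqWord κ μ) : 𝔸ˣ) : 𝔸) := by
      rw [mul_sub, sub_mul, mul_one, Units.mul_inv]; abel
    rw [hrw] at hconj
    have htri := norm_sub_le_norm_sub_add_norm_sub
      (((hol (gaugeAct (axialFn V y) V) (x + e ν) (plaqWord κ μ) : 𝔸ˣ) : 𝔸))
      (((gaugeAct (axialFn V y) V x ν : 𝔸ˣ) : 𝔸) *
          ((hol (gaugeAct (axialFn V y) V) (x + e ν) (plaqWord κ μ) : 𝔸ˣ) : 𝔸) *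
          (((gaugeAct (axialFn V y) V x ν)⁻¹ : 𝔸ˣ) : 𝔸))
      (((hol (gaugeAct (axialFn V y) V) x (plaqWord κ μ) : 𝔸ˣ) : 𝔸))
    have h2 : 2 * ‖((gaugeAct (axialFn V y) V x ν : 𝔸ˣ) : 𝔸) - 1‖ *
        ‖((hol (gaugeAct (axialFn V y) V) (x + e ν) (plaqWord κ μ) : 𝔸ˣ) : 𝔸) - 1‖ ≤
        2 * ((l1 (x - y) : ℝ) * α) * α := by gcongr
    rw [norm_sub_rev] at hconj
    linarith
  have hinv := norm_inv_sub_inv_le hP'm hPm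
  rw [e1, e2, Units.val_mul, Units.val_mul]
  calc _ ≤ _ + _ := norm_mul_sub_mul_le ((U1 𝔸).inv_mem hP'm).1 (hV₀ _ _).1
    _ ≤ _ := by linarith

/-- **THE GRADIENT ALONG THE CONTOUR'S LATER DIRECTIONS** (`μ ≤ ν`): by induction on `|x − y|₁`, peeling the lowest non-vanishing coordinate,
`|V₀(x+e_ν,μ) − V₀(x,μ)| ≤ |x−y|₁·(x₁ + 2Dα²)` whenever `|x − y|₁ ≤ D`. [folklore] -/
private theorem axial_shift_bound_of_le {V : Site d → Fin d → 𝔸ˣ} (hV : ∀ x κ, V x κ ∈ U1 𝔸) {α x₁ : ℝ} (hα : 0 ≤ α) (hx₁ : 0 ≤ x₁)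
    (h44 : ∀ (x : Site d) (κ μ : Fin d), κ ≠ μ → ‖((hol V x (plaqWord κ μ) : 𝔸ˣ) : 𝔸) - 1‖ ≤ α)
    (hG : ∀ (p : Site d) (ν κ μ : Fin d), κ ≠ μ →
      ‖(V p ν : 𝔸) * ((hol V (p + e ν) (plaqWord κ μ) : 𝔸ˣ) : 𝔸) * (((V p ν)⁻¹ : 𝔸ˣ) : 𝔸)
        - ((hol V p (plaqWord κ μ) : 𝔸ˣ) : 𝔸)‖ ≤ x₁)
    (y : Site d) (D : ℕ) {μ ν : Fin d} (hμν : μ ≤ ν) :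
    ∀ (n : ℕ) (x : Site d), l1 (x - y) = n → n ≤ D →
      ‖((gaugeAct (axialFn V y) V (x + e ν) μ : 𝔸ˣ) : 𝔸) - ((gaugeAct (axialFn V y) V x μ : 𝔸ˣ) : 𝔸)‖ ≤
        n * (x₁ + 2 * (D : ℝ) * α * α) := by
  -- tree bonds: when `x − y` vanishes below `μ` both bond variables are `1`
  have htree : ∀ x : Site d, (∀ ι, ι < μ → (x - y) ι = 0) →
      ‖((gaugeAct (axialFn V y) V (x + e ν) μ : 𝔸ˣ) : 𝔸) - ((gaugeAct (axialFn V y) V x μ : 𝔸ˣ) : 𝔸)‖ = 0 := by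
    intro x hx
    have hx' : ∀ ι, ι < μ → (x + e ν - y) ι = 0 := by simpa only [one_smul] using lowerZero_shift hμν hx 1
    rw [axial_tree_bond V y x μ hx, axial_tree_bond V y (x + e ν) μ hx', sub_self, norm_zero]
  have hc : 0 ≤ x₁ + 2 * (D : ℝ) * α * α := by positivity
  intro n
  induction n with
  | zero =>
    intro x hx _
    have h0 : ∀ ι, ι < μ → (x - y) ι = 0 := fun ι _ => eq_zero_of_l1_eq_zero hx ι
    rw [htree x h0]; simp
  | succ n ih =>
    intro x hx hnD
    by_cases hlow : ∀ ι, ι < μ → (x - y) ι = 0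
    · rw [htree x hlow]; positivity
    obtain ⟨κ, hκμ, hκ0, hκlow⟩ := exists_lowest_ne_zero hlow
    rcases lt_or_gt_of_ne hκ0 with hneg | hpos
    · -- negative side: peel towards `x + e_κ`
      have hl1 : l1 (x + e κ - y) = n := by
        have := l1_add_e_add_one (v := x - y) hneg
        rw [show x - y + e κ = x + e κ - y by abel, hx] at this
        omega
      have hlow' : ∀ ι, ι < κ → (x + e κ - y) ι = 0 := by simpa only [one_smul] using lowerZero_shift le_rfl hκlow 1
      have hstep := axial_shift_peel_neg hV hα h44 hG y x hκμ hμν hκlow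
      have hih := ih (x + e κ) hl1 (by omega)
      have hxr : ((l1 (x - y) : ℕ) : ℝ) ≤ D := by exact_mod_cast hx ▸ hnD
      have h2 : 2 * ((l1 (x - y) : ℝ) * α) * α ≤ 2 * (D : ℝ) * α * α := by nlinarith [mul_nonneg hα hα]
      push_cast
      linarith
    · -- positive side: peel towards `x − e_κ`
      have hl1 : l1 (x - e κ - y) = n := by
        have := l1_sub_e_add_one (v := x - y) hpos
        rw [show x - y - e κ = x - e κ - y by abel, hx] at this
        omega
      have hlow' : ∀ ι, ι < κ → (x - e κ - y) ι = 0 := by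
        simpa only [neg_smul, one_smul, ← sub_eq_add_neg] using lowerZero_shift le_rfl hκlow (-1)
      have hstep := axial_shift_peel_pos hV hα h44 hG y x hκμ hμν hκlow
      have hih := ih (x - e κ) hl1 (by omega)
      have hxr : ((l1 (x - e κ - y) : ℕ) : ℝ) ≤ D := by exact_mod_cast hl1 ▸ (Nat.le_of_succ_le hnD)
      have h2 : 2 * ((l1 (x - e κ - y) : ℝ) * α) * α ≤ 2 * (D : ℝ) * α * α := by nlinarith [mul_nonneg hα hα]
      push_cast
      linarith

/-- **THE BOND GRADIENT IN THE COMPLETE AXIAL GAUGE** (every bond direction `μ`, every shift `e_ν`): for a `U1`-valued `V` with plaquettes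
within `α` of `1` and transported plaquette gradients `≤ x₁`, `V₀ = V^{v₀}`, `v₀ = axialFn V y`, and `|x − y|₁ ≤ D`:
`|V₀(x+e_ν, μ) − V₀(x, μ)| ≤ α + D·x₁ + (2D + 4D²)·α²` (the case `ν < μ` by the swap identity from the case `μ < ν` and B7's bond bound
`|V₀(b) − 1| ≤ |b₋ − y|₁α`). [folklore] -/
private theorem axial_shift_bound {V : Site d → Fin d → 𝔸ˣ} (hV : ∀ x κ, V x κ ∈ U1 𝔸) {α x₁ : ℝ} (hα : 0 ≤ α) (hx₁ : 0 ≤ x₁)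
    (h44 : ∀ (x : Site d) (κ μ : Fin d), κ ≠ μ → ‖((hol V x (plaqWord κ μ) : 𝔸ˣ) : 𝔸) - 1‖ ≤ α)
    (hG : ∀ (p : Site d) (ν κ μ : Fin d), κ ≠ μ →
      ‖(V p ν : 𝔸) * ((hol V (p + e ν) (plaqWord κ μ) : 𝔸ˣ) : 𝔸) * (((V p ν)⁻¹ : 𝔸ˣ) : 𝔸)
        - ((hol V p (plaqWord κ μ) : 𝔸ˣ) : 𝔸)‖ ≤ x₁)
    (y x : Site d) {D : ℕ} (hD : l1 (x - y) ≤ D) (ν μ : Fin d) :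
    ‖((gaugeAct (axialFn V y) V (x + e ν) μ : 𝔸ˣ) : 𝔸) - ((gaugeAct (axialFn V y) V x μ : 𝔸ˣ) : 𝔸)‖ ≤
      α + D * x₁ + (2 * D + 4 * (D : ℝ) ^ 2) * α ^ 2 := by
  have hu : ∀ z, axialFn V y z ∈ U1 𝔸 := axialFn_mem hV y
  have hV₀ : ∀ z κ, gaugeAct (axialFn V y) V z κ ∈ U1 𝔸 := gaugeAct_mem hV hu
  have hnD : ((l1 (x - y) : ℕ) : ℝ) ≤ D := by exact_mod_cast hD
  have hD0 : (0 : ℝ) ≤ D := Nat.cast_nonneg D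
  rcases le_or_gt μ ν with hμν | hνμ
  · have h := axial_shift_bound_of_le hV hα hx₁ h44 hG y D hμν (l1 (x - y)) x rfl hD
    have h1 : ((l1 (x - y) : ℕ) : ℝ) * (x₁ + 2 * (D : ℝ) * α * α) ≤ D * (x₁ + 2 * (D : ℝ) * α * α) :=
      mul_le_mul_of_nonneg_right hnD (by positivity)
    nlinarith [mul_nonneg hD0 (mul_nonneg hα hα), mul_nonneg hα hα]
  · -- swap, then the case `ν < μ` of the bond direction `ν` shifted by `e_μ`
    have hswap := norm_shift_sub_le_swap hV₀ (plaq_bound_gaugeAct hu h44) x hνμ.ne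
    have h := axial_shift_bound_of_le hV hα hx₁ h44 hG y D hνμ.le (l1 (x - y)) x rfl hD
    have h1 : ((l1 (x - y) : ℕ) : ℝ) * (x₁ + 2 * (D : ℝ) * α * α) ≤ D * (x₁ + 2 * (D : ℝ) * α * α) :=
      mul_le_mul_of_nonneg_right hnD (by positivity)
    have hbν : ‖((gaugeAct (axialFn V y) V x ν : 𝔸ˣ) : 𝔸) - 1‖ ≤ (D : ℝ) * α :=
      (axial_bond_bound V hV y h44 hα x ν).trans (mul_le_mul_of_nonneg_right hnD hα)
    have hbμ : ‖((gaugeAct (axialFn V y) V x μ : 𝔸ˣ) : 𝔸) - 1‖ ≤ (D : ℝ) * α :=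
      (axial_bond_bound V hV y h44 hα x μ).trans (mul_le_mul_of_nonneg_right hnD hα)
    have h2 : 2 * ‖((gaugeAct (axialFn V y) V x ν : 𝔸ˣ) : 𝔸) - 1‖ *
        (α + ‖((gaugeAct (axialFn V y) V x μ : 𝔸ˣ) : 𝔸) - 1‖) ≤ 2 * ((D : ℝ) * α) * (α + (D : ℝ) * α) := by
      gcongr
    nlinarith [mul_nonneg hD0 (mul_nonneg hα hα), mul_nonneg hα hα]

end Gradient

/-! ## §6 The regularity condition (3.35) -/

section Reg335

/-- real arithmetic of the `|A|`-bound: `η⁻¹·2ρα₀η² = 2(ρη)α₀ ≤ 2Mα₀` for `ρη ≤ Mt`, `t ≤ 1`. [folklore] -/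
private theorem aux_sup_bound {η t M α₀ ρ : ℝ} (hη : 0 < η) (ht1 : t ≤ 1) (hM : 0 ≤ M) (hα₀ : 0 ≤ α₀)
    (hρ : ρ * η ≤ M * t) :
    η⁻¹ * (2 * (ρ * (α₀ * η ^ 2))) ≤ 2 * M * α₀ := by
  have hs : ρ * η ≤ M := hρ.trans (by nlinarith)
  have e : η⁻¹ * (2 * (ρ * (α₀ * η ^ 2))) = 2 * (ρ * η) * α₀ * (η⁻¹ * η) := by ring
  rw [e, inv_mul_cancel₀ hη.ne', mul_one]
  nlinarith

/-- real arithmetic of the `|∇A|`-bound: `2η⁻²(α₀η² + ρc₀η³ + (2ρ + 4ρ²)α₀²η⁴) ≤ 2α₀ + 2Mc₀ + 4M(1+2M)α₀²` for `ρη ≤ Mt`, `t, η ≤ 1`.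
[folklore] -/
private theorem aux_grad_bound {η t M α₀ c₀ ρ : ℝ} (hη : 0 < η) (hη1 : η ≤ 1) (ht1 : t ≤ 1) (hM : 0 ≤ M)
    (hc₀ : 0 ≤ c₀) (hρ0 : 0 ≤ ρ) (hρ : ρ * η ≤ M * t) :
    η⁻¹ * (η⁻¹ * (2 * (α₀ * η ^ 2 + ρ * (c₀ * η ^ 3) + (2 * ρ + 4 * ρ ^ 2) * (α₀ * η ^ 2) ^ 2))) ≤
      2 * α₀ + 2 * M * c₀ + 4 * M * (1 + 2 * M) * α₀ ^ 2 := by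
  have hs : ρ * η ≤ M := hρ.trans (by nlinarith)
  have hs0 : 0 ≤ ρ * η := mul_nonneg hρ0 hη.le
  have e : η⁻¹ * (η⁻¹ * (2 * (α₀ * η ^ 2 + ρ * (c₀ * η ^ 3) + (2 * ρ + 4 * ρ ^ 2) * (α₀ * η ^ 2) ^ 2))) =
      2 * (α₀ + (ρ * η) * c₀ + 2 * (ρ * η) * α₀ ^ 2 * η + 4 * (ρ * η) ^ 2 * α₀ ^ 2) * (η⁻¹ * η) ^ 2 := by ring
  rw [e, inv_mul_cancel₀ hη.ne', one_pow, mul_one]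
  have h1 : (ρ * η) * c₀ ≤ M * c₀ := mul_le_mul_of_nonneg_right hs hc₀
  have h2 : 2 * (ρ * η) * α₀ ^ 2 * η ≤ 2 * M * α₀ ^ 2 := by
    have : (ρ * η) * η ≤ M * 1 := by nlinarith
    nlinarith [sq_nonneg α₀]
  have h3 : 4 * (ρ * η) ^ 2 * α₀ ^ 2 ≤ 4 * M ^ 2 * α₀ ^ 2 := by
    have : (ρ * η) ^ 2 ≤ M ^ 2 := pow_le_pow_left₀ hs0 hs 2
    nlinarith [sq_nonneg α₀]
  nlinarith

variable {𝔸 : Type*} [NormedRing 𝔸] [NormedAlgebra ℂ 𝔸] [CompleteSpace 𝔸] [NormOneClass 𝔸]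

/-- **(3.35) FROM THE TWO RADII, IN THE COMPLETE AXIAL GAUGE.**  A `U1`-valued configuration `V` on `ℤᵈ` whose plaquette variables are within
`α₀η²` of `1` and whose transported plaquette differences are `≤ c₀η³` satisfies «the regularity condition (3.35) in [4]» (`Reg335Zd η L 𝒬 C V`)
for EVERY family `𝒬` of indexed sets `(□, j)` at scales `Lʲη ≤ 1` with `□` inside an `ℓ¹`-ball of radius `M·Lʲ`, and every
`C > 2(M+1)α₀ + 2Mc₀ + 4M(1+2M)α₀²`, provided `(M+1)α₀ ≤ ½`, `0 < η ≤ 1`: on `□ ∋ z` around `y` take `u = axialFn V y` and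
`A = (iη)⁻¹ log V^u`.  NOT print's derivation (B8 p. 99 uses Theorem 4); an elementary sufficient criterion under the extra gradient radius.
[cite: Balaban1985BackgroundPropagators, (3.35) p.396; Balaban1985RegularSpaces, (1.33) p.82, p.99; Balaban1985Averaging, pp.24–25] -/
theorem reg335Zd_of_plaq_radii {V : Site d → Fin d → 𝔸ˣ} (hV : ∀ x κ, V x κ ∈ U1 𝔸)
    {η : ℝ} (hη : 0 < η) (hη1 : η ≤ 1) {L : ℕ} (hL : 1 ≤ L) {α₀ c₀ M : ℝ} (hα₀ : 0 ≤ α₀) (hc₀ : 0 ≤ c₀) (hM : 0 ≤ M)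
    (hsmall : (M + 1) * α₀ ≤ 1 / 2)
    (h44 : ∀ (x : Site d) (κ μ : Fin d), κ ≠ μ → ‖((hol V x (plaqWord κ μ) : 𝔸ˣ) : 𝔸) - 1‖ ≤ α₀ * η ^ 2)
    (hG : ∀ (p : Site d) (ν κ μ : Fin d), κ ≠ μ →
      ‖(V p ν : 𝔸) * ((hol V (p + e ν) (plaqWord κ μ) : 𝔸ˣ) : 𝔸) * (((V p ν)⁻¹ : 𝔸ˣ) : 𝔸)
        - ((hol V p (plaqWord κ μ) : 𝔸ˣ) : 𝔸)‖ ≤ c₀ * η ^ 3)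
    {𝒬 : Set (Set (Site d) × ℕ)}
    (h𝒬 : ∀ q ∈ 𝒬, (L : ℝ) ^ q.2 * η ≤ 1 ∧ ∃ y : Site d, ∀ z ∈ q.1, (l1 (z - y) : ℝ) ≤ M * (L : ℝ) ^ q.2)
    {C : ℝ} (hC : 2 * (M + 1) * α₀ + 2 * M * c₀ + 4 * M * (1 + 2 * M) * α₀ ^ 2 < C) :
    Reg335Zd η L 𝒬 C V := by
  rw [reg335Zd_iff]
  rintro ⟨Q, j⟩ hq
  obtain ⟨ht1, y, hQ⟩ := h𝒬 _ hq
  dsimp only at ht1 hQ ⊢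
  -- letters and elementary facts
  have ha : 0 ≤ α₀ * η ^ 2 := by positivity
  have hx₁ : 0 ≤ c₀ * η ^ 3 := by positivity
  have hL1 : (1 : ℝ) ≤ L := by exact_mod_cast hL
  have ht_pos : 0 < (L : ℝ) ^ j * η := by positivity
  have hξ : scaleLen (L : ℝ) η j = (L : ℝ) ^ j * η := rfl
  have hC0 : 0 < C := lt_of_le_of_lt (by positivity) hC
  have hu : ∀ z, axialFn V y z ∈ U1 𝔸 := axialFn_mem hV y
  have hV₀ : ∀ z κ, gaugeAct (axialFn V y) V z κ ∈ U1 𝔸 := gaugeAct_mem hV hu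
  have hIη : (Complex.I * η : ℂ) ≠ 0 := mul_ne_zero Complex.I_ne_zero (by exact_mod_cast hη.ne')
  have hnIη : ‖(Complex.I * η : ℂ)⁻¹‖ = η⁻¹ := by
    rw [norm_inv, norm_mul, Complex.norm_I, one_mul, Complex.norm_real, Real.norm_eq_abs, abs_of_pos hη]
  -- the bond bound of B7 p. 25, at `z ∈ □` and at `z + e_κ`
  have hρη : ∀ z ∈ Q, (l1 (z - y) : ℝ) * η ≤ M * ((L : ℝ) ^ j * η) := fun z hz => by
    have := mul_le_mul_of_nonneg_right (hQ z hz) hη.le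
    linarith
  have hb1 : ∀ z ∈ Q, ∀ κ, ‖((gaugeAct (axialFn V y) V z κ : 𝔸ˣ) : 𝔸) - 1‖ ≤ (l1 (z - y) : ℝ) * (α₀ * η ^ 2) :=
    fun z _ κ => axial_bond_bound V hV y h44 ha z κ
  have hb1' : ∀ z ∈ Q, ∀ κ, ‖((gaugeAct (axialFn V y) V z κ : 𝔸ˣ) : 𝔸) - 1‖ ≤ 1 / 2 := fun z hz κ => by
    refine (hb1 z hz κ).trans ?_
    have h1 : (l1 (z - y) : ℝ) * (α₀ * η ^ 2) = ((l1 (z - y) : ℝ) * η) * α₀ * η := by ring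
    rw [h1]
    have h2 : ((l1 (z - y) : ℝ) * η) * α₀ * η ≤ M * α₀ * 1 := by
      have := hρη z hz
      have hMt : M * ((L : ℝ) ^ j * η) ≤ M := by nlinarith
      have : (l1 (z - y) : ℝ) * η ≤ M := this.trans hMt
      have h3 : ((l1 (z - y) : ℝ) * η) * α₀ ≤ M * α₀ := mul_le_mul_of_nonneg_right this hα₀
      have h4 : 0 ≤ ((l1 (z - y) : ℝ) * η) * α₀ := by positivity
      nlinarith
    nlinarith
  have hb2' : ∀ z ∈ Q, ∀ κ ν, ‖((gaugeAct (axialFn V y) V (z + e κ) ν : 𝔸ˣ) : 𝔸) - 1‖ ≤ 1 / 2 := fun z hz κ ν => by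
    refine (axial_bond_bound V hV y h44 ha (z + e κ) ν).trans ?_
    have hl : (l1 (z + e κ - y) : ℝ) ≤ l1 (z - y) + 1 := by
      have h := l1_add_le (z - y) (e κ)
      rw [show z - y + e κ = z + e κ - y by abel, show l1 (e κ : Site d) = 1 from l1_vec ((κ, true) : Letter d)] at h
      exact_mod_cast h
    have hMt : M * ((L : ℝ) ^ j * η) ≤ M := by nlinarith
    have hs : (l1 (z - y) : ℝ) * η ≤ M := (hρη z hz).trans hMt
    calc (l1 (z + e κ - y) : ℝ) * (α₀ * η ^ 2) ≤ ((l1 (z - y) : ℝ) + 1) * (α₀ * η ^ 2) := mul_le_mul_of_nonneg_right hl ha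
      _ = ((l1 (z - y) : ℝ) * η) * α₀ * η + α₀ * η ^ 2 := by ring
      _ ≤ M * α₀ * 1 + α₀ * 1 := by
          gcongr
          · nlinarith
      _ = (M + 1) * α₀ := by ring
      _ ≤ 1 / 2 := hsmall
  refine ⟨axialFn V y, fun κ z => (Complex.I * η : ℂ)⁻¹ • mlog ((gaugeAct (axialFn V y) V z κ : 𝔸ˣ) : 𝔸), ?_, ?_, ?_, ?_⟩
  · exact fun z _ => ⟨(hu z).1, (hu z).2⟩
  · -- `V^u = e^{iηA}` on `□`: `exp (log V^u) = V^u` since `|V^u − 1| ≤ ½ < 1`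
    intro κ z hz
    have hlt : ‖((gaugeAct (axialFn V y) V z κ : 𝔸ˣ) : 𝔸) - 1‖ < 1 := (hb1' z hz κ).trans_lt (by norm_num)
    ext
    simp only [byDir_apply, fluct, B9Eq37Insertion.val_holU, Beta.TransportVertices.holonomy_cons,
      Beta.TransportVertices.holonomy_nil, mul_one, smul_smul, mul_inv_cancel₀ hIη, one_smul]
    exact (exp_mlog hlt).symm
  · -- `|A| < C(Lʲη)⁻¹`
    intro κ z hz
    rw [norm_smul, hnIη, hξ]
    have hm : ‖mlog ((gaugeAct (axialFn V y) V z κ : 𝔸ˣ) : 𝔸)‖ ≤ 2 * ((l1 (z - y) : ℝ) * (α₀ * η ^ 2)) :=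
      (norm_mlog_le_two_mul (hb1' z hz κ)).trans (by linarith [hb1 z hz κ])
    have h1 : η⁻¹ * ‖mlog ((gaugeAct (axialFn V y) V z κ : 𝔸ˣ) : 𝔸)‖ ≤ 2 * M * α₀ :=
      (mul_le_mul_of_nonneg_left hm (inv_nonneg.mpr hη.le)).trans (aux_sup_bound hη ht1 hM hα₀ (hρη z hz))
    have h2 : 2 * M * α₀ < C := by nlinarith
    calc η⁻¹ * ‖mlog ((gaugeAct (axialFn V y) V z κ : 𝔸ˣ) : 𝔸)‖ ≤ 2 * M * α₀ := h1
      _ < C := h2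
      _ ≤ C * ((L : ℝ) ^ j * η)⁻¹ := by
          have : 1 ≤ ((L : ℝ) ^ j * η)⁻¹ := one_le_inv_iff₀.mpr ⟨ht_pos, ht1⟩
          nlinarith
  · -- `|∇^ηA| < C(Lʲη)⁻²`: the flat difference of `log V^u` is `2`-Lipschitz in the bond variables on `|· − 1| ≤ ½`
    intro κ ν z hz
    have hcov : covD (shiftT d) (fun _ _ => (1 : 𝔸ˣ)) κ
          (fun w => (Complex.I * η : ℂ)⁻¹ • mlog ((gaugeAct (axialFn V y) V w ν : 𝔸ˣ) : 𝔸)) z =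
        (Complex.I * η : ℂ)⁻¹ • (mlog ((gaugeAct (axialFn V y) V (z + e κ) ν : 𝔸ˣ) : 𝔸)
          - mlog ((gaugeAct (axialFn V y) V z ν : 𝔸ˣ) : 𝔸)) := by
      simp only [covD, R, shiftT_apply, Units.val_one, inv_one, one_mul, mul_one, smul_sub]
    have hnη : ‖((η : ℂ)⁻¹)‖ = η⁻¹ := by
      rw [norm_inv, Complex.norm_real, Real.norm_eq_abs, abs_of_pos hη]
    have hlip : ‖mlog ((gaugeAct (axialFn V y) V (z + e κ) ν : 𝔸ˣ) : 𝔸) - mlog ((gaugeAct (axialFn V y) V z ν : 𝔸ˣ) : 𝔸)‖ ≤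
        2 * ‖((gaugeAct (axialFn V y) V (z + e κ) ν : 𝔸ˣ) : 𝔸) - ((gaugeAct (axialFn V y) V z ν : 𝔸ˣ) : 𝔸)‖ := by
      have h := FederbushMean.norm_mlog_sub_mlog_le (ρ := 1 / 2) (by norm_num) (hb2' z hz κ ν) (hb1' z hz ν)
      norm_num at h
      exact h
    have hshift := axial_shift_bound hV ha hx₁ h44 hG y z (D := l1 (z - y)) le_rfl κ ν
    have hK := aux_grad_bound (α₀ := α₀) hη hη1 ht1 hM hc₀ (Nat.cast_nonneg (l1 (z - y))) (hρη z hz)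
    have hKC : 2 * α₀ + 2 * M * c₀ + 4 * M * (1 + 2 * M) * α₀ ^ 2 < C := by nlinarith
    dsimp only
    rw [hcov, norm_smul, norm_smul, hnη, hnIη, hξ]
    have hηi : 0 ≤ η⁻¹ := inv_nonneg.mpr hη.le
    calc η⁻¹ * (η⁻¹ * ‖mlog ((gaugeAct (axialFn V y) V (z + e κ) ν : 𝔸ˣ) : 𝔸) - mlog ((gaugeAct (axialFn V y) V z ν : 𝔸ˣ) : 𝔸)‖)
        ≤ η⁻¹ * (η⁻¹ * (2 * (α₀ * η ^ 2 + (l1 (z - y) : ℝ) * (c₀ * η ^ 3) +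
            (2 * (l1 (z - y) : ℝ) + 4 * (l1 (z - y) : ℝ) ^ 2) * (α₀ * η ^ 2) ^ 2))) := by
          gcongr
          exact hlip.trans (by linarith)
      _ ≤ 2 * α₀ + 2 * M * c₀ + 4 * M * (1 + 2 * M) * α₀ ^ 2 := hK
      _ < C := hKC
      _ ≤ C * (((L : ℝ) ^ j * η) ^ 2)⁻¹ := by
          have : 1 ≤ (((L : ℝ) ^ j * η) ^ 2)⁻¹ := one_le_inv_iff₀.mpr ⟨by positivity, by nlinarith⟩
          nlinarith

/-- **THE CLASS (3.35) IS GAUGE INVARIANT**: if `V` satisfies (3.35) with the gauges `u_□`, then `V^{v}` satisfies it with the gauges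
`u_□·v⁻¹`, for every `U1`-valued `v` («U^u = e^{iηA}» is a statement about the orbit). [cite: Balaban1985BackgroundPropagators, (3.35) p.396, (3.28) p.395] -/
theorem reg335Zd_gaugeAct {V : Site d → Fin d → 𝔸ˣ} {η : ℝ} {L : ℕ} {𝒬 : Set (Set (Site d) × ℕ)} {C : ℝ}
    (h : Reg335Zd η L 𝒬 C V) {v : Site d → 𝔸ˣ} (hv : ∀ x, v x ∈ U1 𝔸) :
    Reg335Zd η L 𝒬 C (gaugeAct v V) := by
  rw [reg335Zd_iff] at h ⊢
  intro q hq
  obtain ⟨u, A, hu, hrep, hA, hD⟩ := h q hq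
  refine ⟨fun z => u z * (v z)⁻¹, A, fun z hz => ⟨?_, ?_⟩, fun κ z hz => ?_, hA, hD⟩
  · rw [Units.val_mul]
    exact (norm_mul_le _ _).trans (mul_le_one₀ (hu z hz).1 (norm_nonneg _) (hv z).2)
  · rw [mul_inv_rev, inv_inv, Units.val_mul]
    exact (norm_mul_le _ _).trans (mul_le_one₀ (hv z).1 (norm_nonneg _) (hu z hz).2)
  · rw [← hrep κ z hz, byDir_apply, byDir_apply]
    simp only [gaugeAct, mul_inv_rev, inv_inv, mul_assoc, inv_mul_cancel_left]

end Reg335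

end

end Literature.MathematicalPhysics.QuantumFieldTheory.Balaban1983to89.B9Eq335AxialCriterion
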